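import Literature.NumberTheory.Automorphic.ClozelAlgebraicityPurityProofs
import Literature.Barriers.Langlands.NonRegularWeightBarrier
import Literature.NumberTheory.DiophantineGeometry.GLHighestWeightFacts
import HarnessLib

/-!
# Regular algebraic infinity types are cohomological (Clozel 1990, Lemme 3.14), on `a`-multisets

Topic `NumberTheory/Automorphic`; theorems only. Clozel 1990, §3.5, Lemme 3.14: a regular algebraic
`π_∞` has `(𝔤, K_∞)`-cohomology with coefficients in an algebraic representation `V_λ` (after the
twist by `|det|^{(1-n)/2}` built into "C-algebraic"); equivalently its Harish-Chandra parameter is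
`λ^∨ + ρ` for a DOMINANT integral `λ`. In the tree's language (`InfinityType`, the `a`-multisets
read by `HasInfinityType`, and the barrier file's `cohomologicalInfinityType n K wt`, whose
`a`-exponents are `wt i + ρ_i`):

* `exists_antitone_map_add_rhoGL_of_nodup` — combinatorial core: a multiset of `n` DISTINCT
  numbers of the form `k + (n-1)/2`, `k ∈ ℤ`, is `{wt i + ρ_i : i}` for an antitone (dominant)
  `wt : Fin n → ℤ` (sort the integers decreasingly, `k_0 > k_1 > ⋯`, and put `wt i = k_i + i`).
* `InfinityType.IsRegularAlgebraic.exists_isDominant_map_a_eq_cohomological` — over `K = ℚ`: a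
  regular algebraic infinity type with `n` weights has the `a`-multiset of
  `cohomologicalInfinityType n ℚ wt` for a dominant `wt`.
* `AutomorphicRepData.IsRegularAlgebraic.exists_hasInfinityType_cohomological` — hence a regular
  algebraic automorphic representation of `GL_n(𝔸_ℚ)` has the infinity type
  `cohomologicalInfinityType n ℚ (Weight.dual wt)` for some dominant `wt` (the hypothesis shape of
  the named fact `GLnCohomology.cuspidalEigenclass_exists` of `CuspidalCohomologyGL`).

## References

* L. Clozel, *Motifs et formes automorphes* (1990), §1.8 (Déf. 1.8), §3.5 (Lemme 3.14). [Clozel1990]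
* A. Borel, N. Wallach, *Continuous cohomology, discrete subgroups, and representations of
  reductive groups*, 2nd ed. (2000), I Thm. 5.3, III 1.5 (Wigner's lemma). [BorelWallach2000]
-/

noncomputable section

open scoped Classical

namespace Literature.NumberTheory.Automorphic

open Literature.NumberTheory.DiophantineGeometry Literature.Barriers.Langlands

/-! ### Combinatorial core: sorting a regular half-integral multiset -/

section Core

/-- A strictly decreasing integer-valued function on `Fin n` drops by at least the index
difference: `f j + j ≤ f i + i` for `i ≤ j`. [folklore] -/
theorem StrictAnti.apply_add_le {n : ℕ} {f : Fin n → ℤ} (hf : StrictAnti f) {i j : Fin n}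
    (hij : i ≤ j) : f j + (j : ℕ) ≤ f i + (i : ℕ) := by
  -- induction on the distance `j - i`
  obtain ⟨d, hd⟩ : ∃ d : ℕ, (j : ℕ) = i + d := ⟨j - i, by omega⟩
  induction d generalizing j with
  | zero =>
    have : j = i := Fin.ext (by omega)
    subst this
    exact le_rfl
  | succ d ih =>
    have hj' : (i : ℕ) + d < n := by omega
    set j' : Fin n := ⟨i + d, hj'⟩ with hj'def
    have h1 : f j' + ((j' : ℕ) : ℤ) ≤ f i + (i : ℕ) := ih (Fin.le_def.2 (by simp [hj'def])) rfl
    have hlt : j' < j := Fin.lt_def.2 (by simp [hj'def]; omega)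
    have h2 : f j < f j' := hf hlt
    have h3 : ((j : ℕ) : ℤ) = (j' : ℕ) + 1 := by simp [hj'def]; omega
    omega

/-- **Enumerating a finite set of integers decreasingly**: a multiset of `n` distinct integers is
`{f 0 > f 1 > ⋯ > f (n-1)}` for a strictly decreasing `f : Fin n → ℤ` (induction on `n`, splitting
off the maximum). [folklore] -/
theorem exists_strictAnti_map_univ_eq :
    ∀ (n : ℕ) (Ks : Multiset ℤ), Ks.Nodup → Multiset.card Ks = n →
      ∃ f : Fin n → ℤ, StrictAnti f ∧ Finset.univ.val.map f = Ks := by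
  intro n
  induction n with
  | zero =>
    intro Ks _ hcard
    refine ⟨Fin.elim0, fun i ↦ Fin.elim0 i, ?_⟩
    rw [Multiset.card_eq_zero.1 hcard]
    rfl
  | succ n ih =>
    intro Ks hnd hcard
    have hne : Ks ≠ 0 := fun h ↦ by rw [h] at hcard; simp at hcard
    obtain ⟨m, hm, hmax⟩ := Multiset.exists_max_image (id : ℤ → ℤ) hne
    obtain ⟨Ks', rfl⟩ := Multiset.exists_cons_of_mem hm
    have hnd' : Ks'.Nodup := (Multiset.nodup_cons.1 hnd).2
    have hm' : m ∉ Ks' := (Multiset.nodup_cons.1 hnd).1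
    have hcard' : Multiset.card Ks' = n := by
      rw [Multiset.card_cons] at hcard
      omega
    obtain ⟨f', hf', hmap'⟩ := ih Ks' hnd' hcard'
    have hlt : ∀ i, f' i < m := by
      intro i
      have hmem : f' i ∈ Ks' := by
        rw [← hmap']
        exact Multiset.mem_map_of_mem _ (Finset.mem_univ_val i)
      have hle : f' i ≤ m := hmax _ (Multiset.mem_cons_of_mem hmem)
      exact lt_of_le_of_ne hle fun h ↦ hm' (h ▸ hmem)
    refine ⟨Fin.cons m f', fun i j hij ↦ ?_, ?_⟩
    · -- strictly decreasing: `i < j ⊢ cons m f' j < cons m f' i`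
      rcases Fin.eq_zero_or_eq_succ j with rfl | ⟨j', rfl⟩
      · exact absurd hij (not_lt.2 (Fin.zero_le _))
      · rcases Fin.eq_zero_or_eq_succ i with rfl | ⟨i', rfl⟩
        · simp only [Fin.cons_zero, Fin.cons_succ]
          exact hlt j'
        · simp only [Fin.cons_succ]
          exact hf' (Fin.succ_lt_succ_iff.1 hij)
    · rw [Fin.univ_val_map, List.ofFn_succ]
      simp only [Fin.cons_zero, Fin.cons_succ]
      rw [← Multiset.cons_coe, ← Fin.univ_val_map, hmap']

/-- **Sorting a regular half-integral multiset.** A multiset `M` of `n` pairwise distinct complex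
numbers, each of the form `k + (n-1)/2` with `k ∈ ℤ`, is `{wt i + ρ_i : i < n}` for an ANTITONE
`wt : Fin n → ℤ` (`ρ_i = (n-1)/2 - i`): enumerate the integers decreasingly and add the index.
[folklore] -/
theorem exists_antitone_map_add_rhoGL_of_nodup {n : ℕ} (M : Multiset ℂ) (hcard : Multiset.card M = n)
    (hnodup : M.Nodup) (hhalf : ∀ x ∈ M, ∃ k : ℤ, x = k + ((n : ℂ) - 1) / 2) :
    ∃ wt : Fin n → ℤ, Antitone wt ∧ M = Finset.univ.val.map fun i ↦ (wt i : ℂ) + rhoGL n i := by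
  set c : ℂ := ((n : ℂ) - 1) / 2 with hc
  -- the integer multiset `Ks` with `M = Ks + c`
  let Ks : Multiset ℤ := M.pmap (fun x hx ↦ Classical.choose (hhalf x hx)) fun _ h ↦ h
  have hKs : Ks.map (fun k : ℤ ↦ (k : ℂ) + c) = M := by
    have h1 : Ks.map (fun k : ℤ ↦ (k : ℂ) + c) =
        M.pmap (fun x (hx : x ∈ M) ↦ ((Classical.choose (hhalf x hx) : ℤ) : ℂ) + c) fun _ h ↦ h :=
      Multiset.map_pmap _ _ _ _
    have h2 : M.pmap (fun x (hx : x ∈ M) ↦ ((Classical.choose (hhalf x hx) : ℤ) : ℂ) + c) (fun _ h ↦ h) =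
        M.pmap (fun x (_ : x ∈ M) ↦ x) fun _ h ↦ h :=
      Multiset.pmap_congr M fun x _ h₁ _ ↦ (Classical.choose_spec (hhalf x h₁)).symm
    rw [h1, h2, Multiset.pmap_eq_map, Multiset.map_id']
  have hKcard : Multiset.card Ks = n := by rw [← hcard, ← hKs, Multiset.card_map]
  have hKnodup : Ks.Nodup := by
    have h := hnodup
    rw [← hKs] at h
    exact Multiset.Nodup.of_map _ h
  obtain ⟨f, hf, huniv⟩ := exists_strictAnti_map_univ_eq n Ks hKnodup hKcard
  refine ⟨fun i ↦ f i + (i : ℕ), fun i j hij ↦ StrictAnti.apply_add_le hf hij, ?_⟩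
  calc M = Ks.map fun k : ℤ ↦ (k : ℂ) + c := hKs.symm
    _ = (Finset.univ.val.map f).map fun k : ℤ ↦ (k : ℂ) + c := by rw [huniv]
    _ = Finset.univ.val.map fun i ↦ (((f i + (i : ℕ) : ℤ)) : ℂ) + rhoGL n i := by
      rw [Multiset.map_map]
      refine Multiset.map_congr rfl fun i _ ↦ ?_
      simp only [Function.comp_apply, rhoGL, hc]
      push_cast
      ring

end Core


/-! ### Regular algebraic infinity types over `ℚ` are cohomological -/

section Infinity

variable {n : ℕ}

/-- **Clozel's Lemme 3.14 on `a`-multisets, over `ℚ`.** A regular algebraic infinity type `T` with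
`n` weights at the (unique) complex embedding of `ℚ` has the `a`-multiset of the cohomological type
`cohomologicalInfinityType n ℚ wt` (`a`-exponents `wt i + ρ_i`) for a DOMINANT integral weight
`wt`: the `a`-exponents are `n` distinct elements of `(n-1)/2 + ℤ`, enumerated decreasingly
(`exists_antitone_map_add_rhoGL_of_nodup`). Clozel 1990, Lemme 3.14 (the twist `|·|^{(1-n)/2}` of
loc. cit. is built into the `C`-algebraic normalisation). [cite: Clozel1990, Lemme 3.14] -/
theorem InfinityType.IsRegularAlgebraic.exists_isDominant_map_a_eq_cohomological
    {T : InfinityType ℚ n} (hcard : ∀ σ : ℚ →+* ℂ, Multiset.card (T σ) = n)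
    (hreg : T.IsRegularAlgebraic) :
    ∃ wt : Fin n → ℤ, Weight.IsDominant wt ∧
      ∀ σ : ℚ →+* ℂ, (T σ).map ArchWeight.a =
        (cohomologicalInfinityType n ℚ wt σ).map ArchWeight.a := by
  let σ₀ : ℚ →+* ℂ := Rat.castHom ℂ
  have hσ : ∀ σ : ℚ →+* ℂ, σ = σ₀ := fun σ ↦ Subsingleton.elim σ σ₀
  have hhalf : ∀ x ∈ (T σ₀).map ArchWeight.a, ∃ k : ℤ, x = k + ((n : ℂ) - 1) / 2 := by
    intro x hx
    obtain ⟨p, hp, rfl⟩ := Multiset.mem_map.1 hx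
    obtain ⟨k, l, hk, -⟩ := hreg.1 σ₀ p hp
    exact ⟨k, hk⟩
  obtain ⟨wt, hanti, hM⟩ := exists_antitone_map_add_rhoGL_of_nodup ((T σ₀).map ArchWeight.a)
    (by rw [Multiset.card_map, hcard]) (hreg.2 σ₀) hhalf
  refine ⟨wt, hanti, fun σ ↦ ?_⟩
  rw [hσ σ, hM, cohomologicalInfinityType_apply, Multiset.map_map]
  rfl

/-- **A regular algebraic automorphic representation of `GL_n(𝔸_ℚ)` has a cohomological infinity
type**: `π.HasInfinityType (cohomologicalInfinityType n ℚ λ^∨)` for a dominant integral `λ` — the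
archimedean hypothesis of the named fact `GLnCohomology.cuspidalEigenclass_exists`
(`CuspidalCohomologyGL`). (`HasInfinityType` only reads the `a`-multisets,
`HasInfinityType.of_map_a_eq`; the cohomological type is well formed,
`isWellFormed_cohomologicalInfinityType`.) Clozel 1990, Lemme 3.14. [cite: Clozel1990, Lemme 3.14] -/
theorem AutomorphicRepData.IsRegularAlgebraic.exists_hasInfinityType_cohomological
    {hcpt : isCompact_glFiniteIntegralLevel n ℚ} {π : AutomorphicRepData (AutomorphyDatum.gl n ℚ hcpt)}
    (h : π.IsRegularAlgebraic) :
    ∃ wt : Fin n → ℤ, Weight.IsDominant wt ∧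
      π.HasInfinityType (cohomologicalInfinityType n ℚ (Weight.dual wt)) := by
  obtain ⟨T, hT, hreg⟩ := h
  obtain ⟨wt, hdom, ha⟩ :=
    InfinityType.IsRegularAlgebraic.exists_isDominant_map_a_eq_cohomological hT.1.1 hreg
  refine ⟨Weight.dual wt, Weight.IsDominant.dual hdom, ?_⟩
  rw [Weight.dual_dual]
  exact hT.of_map_a_eq (isWellFormed_cohomologicalInfinityType n ℚ wt) fun κ ↦ (ha κ).symm

end Infinity

/-! ### Any number field: the `a`-multisets, embedding by embedding (appended 2026-08-16) -/

section AnyField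

variable {K : Type*} [Field K] {n : ℕ}

/-- **Clozel's Lemme 3.14 on `a`-multisets over ANY base field, embedding by embedding.** A
regular algebraic infinity type `T` over `K` with `n` weights at every complex embedding has, at
each `σ : K →+* ℂ`, the `a`-multiset `{λ_σ i + ρ_i : i < n}` for a family `λ = (λ_σ)_σ` of
DOMINANT integral weights — over a general `K` the highest weight of the coefficient system of
`Res_{K/ℚ} GL_n` is indexed by the embeddings, and `λ_σ` genuinely depends on `σ` (non-parallel
weights); each `σ` is `exists_antitone_map_add_rhoGL_of_nodup`, assembled by choice. The `K = ℚ`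
case is `exists_isDominant_map_a_eq_cohomological`. Clozel 1990, Lemme 3.14 (regular algebraic
`π_∞` ⇔ cohomological for some `E_μ`, `μ = (μ_σ)_σ`). [cite: Clozel1990, Lemme 3.14] -/
theorem InfinityType.IsRegularAlgebraic.exists_isDominant_forall_map_a_eq
    {T : InfinityType K n} (hcard : ∀ σ : K →+* ℂ, Multiset.card (T σ) = n)
    (hreg : T.IsRegularAlgebraic) :
    ∃ wt : (K →+* ℂ) → Fin n → ℤ, (∀ σ, Weight.IsDominant (wt σ)) ∧
      ∀ σ, (T σ).map ArchWeight.a = Finset.univ.val.map fun i ↦ ((wt σ i : ℤ) : ℂ) + rhoGL n i := by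
  have h : ∀ σ : K →+* ℂ, ∃ wt : Fin n → ℤ, Weight.IsDominant wt ∧
      (T σ).map ArchWeight.a = Finset.univ.val.map fun i ↦ ((wt i : ℤ) : ℂ) + rhoGL n i := by
    intro σ
    refine exists_antitone_map_add_rhoGL_of_nodup ((T σ).map ArchWeight.a)
      (by rw [Multiset.card_map, hcard]) (hreg.2 σ) fun x hx ↦ ?_
    obtain ⟨p, hp, rfl⟩ := Multiset.mem_map.1 hx
    obtain ⟨k, -, hk, -⟩ := hreg.1 σ p hp
    exact ⟨k, hk⟩
  choose wt hdom hmap using h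
  exact ⟨wt, hdom, hmap⟩

/-- The same with the barrier file's `cohomologicalInfinityType`, one dominant weight per
embedding: at each `σ` the `a`-multiset of `T` is the `a`-multiset of
`cohomologicalInfinityType n K (λ σ)` (whose `a`-exponents are `λ σ i + ρ_i`). For non-parallel
`λ` no single `cohomologicalInfinityType n K wt` (constant in `σ`) has these `a`-multisets; the
statement is per embedding. [cite: Clozel1990, Lemme 3.14] -/
theorem InfinityType.IsRegularAlgebraic.exists_isDominant_forall_map_a_eq_cohomological
    {T : InfinityType K n} (hcard : ∀ σ : K →+* ℂ, Multiset.card (T σ) = n)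
    (hreg : T.IsRegularAlgebraic) :
    ∃ wt : (K →+* ℂ) → Fin n → ℤ, (∀ σ, Weight.IsDominant (wt σ)) ∧
      ∀ σ, (T σ).map ArchWeight.a =
        (cohomologicalInfinityType n K (wt σ) σ).map ArchWeight.a := by
  obtain ⟨wt, hdom, hmap⟩ := hreg.exists_isDominant_forall_map_a_eq hcard
  refine ⟨wt, hdom, fun σ ↦ ?_⟩
  rw [hmap σ, cohomologicalInfinityType_apply, Multiset.map_map]
  rfl

end AnyField

end Literature.NumberTheory.Automorphic

end
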